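import Summits.NavierStokesRegularity.OSWSelfSimilar.SheetREvansOdd
import Summits.NavierStokesRegularity.OSWSelfSimilar.SheetRSpectrumWindingLists
import HarnessLib

/-!
# SHEET-ℝ frame, Z3-SR-SPEC S2 — KERNEL ASSEMBLY on the odd class: «the only weak eigenvalue of `A − θℓ(·)f` with `Re σ > −3/100` is `σ = 1`,
# and it is simple», from THREE named hypotheses: the Gårding datum (S1), implementation 2's rectangle label certificate + far field (S2), and
# the known eigenvector at `σ = 1` (P6)

HONEST FRAMING (cell ns-blowup GROUP B / zone Z3, case Z3-SR-SPEC, steps (S1)/(S2) and P-list (P2)/(P3)/(P5)/(P6); 1-D MODEL certificate frame (viscous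
gCLM/OSW sheet on the line at `(a, c_l, ε) = (1/5, 1/2, 1)`); computer-assisted; not Euler/NS; «violates: none — MODEL»). NOTHING in this file is
interval arithmetic and NOTHING here asserts that the hypotheses hold for the sheet: `h : GardingDataKC …` is the (S1) datum, `RectLabelCertificate E`
(cert-2 g7's `SheetRSpectrumWindingLists`, kit j270205 + `rect_from_j270205.json` f71b02691bd71b8b) and the far-field exclusion `hfar` are
implementation 2's (S2) interval sentences, and the weak eigenvector `v` at `σ = 1` is the (P6) gauge mode (cert-5's `SheetRTimeShiftMode*`, for the
concrete data). Given those, the conclusion is KERNEL: by `SheetREvansOdd` (selfsim g12: weak eigenvalue ⇔ zero of the Evans function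
`E(σ) = 1 − θℓ(R_K(σ)f)`, simple zero ⇒ simple weak eigenvalue; built on the injective odd-class resolvent `resolventOdd` and Kato's closed operator)
and `SheetRSpectrumWindingLists.eq_one_of_zero_and_order_one` (cert-2 g7: `certTurns = 4 < 8` + one known zero ⇒ it is the only zero in the open
rectangle `K° = (−3/100, 12) × (−12, 12)` and it is simple, via the tree's `Literature.Analysis.Complex.eq_of_winding_certificate`):

* `analyticOnNhd_evansOdd_rect` — `E` is analytic on a neighbourhood of the closed rectangle once `−m < −3/100`;
* **`weakEigen_iff_eq_one`** — for every `σ` with `Re σ > −3/100`: a non-trivial weak eigenvector of `A − θℓ(·)f` at `σ` exists iff `σ = 1`;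
* **`weakEigen_one_simple`** — at `σ = 1` the weak eigenspace is the line spanned by `R_K(1)f ≠ 0` and no weak generalized eigenvector exists.
In the cell's dictionary (`K := −P* + F`, `f := v₀`, `θℓ := θ(v₀, ·)_E` in its `L²_w`-bounded form, so `A − θℓ(·)f = DG(Ω*)`): «σ_p(−DG(Ω*)|odd) ∩
{Re σ > −3/100} = {1}, algebraically simple» — the PASS word of PREREG-SHEET-R-SPEC, MODULO exactly the three named hypotheses.
Pure composition; no definition, no named fact, no number of record moves.  WHAT THIS IS NOT: not NS; not a proof that the hypotheses hold.
-/

noncomputable section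

namespace Summit.NavierStokesRegularity.OSWSelfSimilar
namespace SheetRSpectrumOddAssembly

open _root_.MeasureTheory _root_.Set _root_.Filter _root_.Real SheetRWeakProfilePV SheetRWeakToStrong SheetREnergyClass SheetRWeightedMeasure
  SheetRLinearisedTests SheetREnergySpace SheetRTestSpace SheetRLinearisedFormBounds SheetRSolutionOperator SheetRLinearisedCutoffEnergy
  SheetRResolventPair SheetRComplexPivot SheetRResolventComplex SheetRResolventIdentity SheetRPerturbedUniqueness SheetRPerturbedPair
  SheetRPerturbedResolventC SheetRPerturbedResolventIdentityC SheetROddClass SheetRResolventOddClass SheetRGeneratorOddWeak SheetREvansOdd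
  SheetRSpectrumWindingLists Literature.Analysis.OperatorTheory Complex
open scoped Topology ENNReal

variable {L D₀ D₁ V₀ c m : ℝ} {d V : ℝ → ℝ}

/-- Points of the closed rectangle `K = [−3/100, 12] × [−12, 12]` lie in the half-plane `Re σ > −m` once `−m < −3/100`. [folklore] -/
theorem re_gt_of_mem_rect (hm : -m < ra) {z : ℂ} (hz : z ∈ Icc ra rb ×ℂ Icc rc rd) : -m < z.re := by
  rw [Complex.mem_reProdIm] at hz
  exact lt_of_lt_of_le hm hz.1.1

/-- **`E` is analytic on a neighbourhood of the closed rectangle** (it is analytic on the half-plane `Re σ > −m ⊃ K`). [folklore] -/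
theorem analyticOnNhd_evansOdd_rect (hL : 0 < L) (K : Esp L hL →L[ℝ] W L) (h : GardingDataKC L hL d V K D₀ D₁ V₀ c m) (hm : -m < ra)
    (ℓ : Wcodd L →L[ℂ] ℂ) (f : Wcodd L) (θ : ℂ) : AnalyticOnNhd ℂ (evansOdd hL K h ℓ f θ) (Icc ra rb ×ℂ Icc rc rd) :=
  (analyticOnNhd_evansOdd hL K h ℓ f θ).mono fun _ hz => re_gt_of_mem_rect hm hz

/-- **THE SPECTRAL SENTENCE, existence/uniqueness half.**  Under the (S1) datum `h` (with `−m < −3/100`), implementation 2's label certificate for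
`E = evansOdd …` on `K`, the far-field exclusion `E(σ) ≠ 0` for `Re σ > −3/100`, `‖σ‖ > 1141/100`, and ONE known non-trivial weak eigenvector `v` at
`σ = 1`: for every `σ` with `Re σ > −3/100`, a non-trivial weak eigenvector of `A − θℓ(·)f` at `σ` exists iff `σ = 1`. [folklore] -/
theorem weakEigen_iff_eq_one (hL : 0 < L) (K : Esp L hL →L[ℝ] W L) (h : GardingDataKC L hL d V K D₀ D₁ V₀ c m) (hm : -m < ra)
    (ℓ : Wcodd L →L[ℂ] ℂ) (f : Wcodd L) (θ : ℂ)
    (hcert : RectLabelCertificate (evansOdd hL K h ℓ f θ))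
    (hfar : ∀ σ : ℂ, ra < σ.re → (1141 : ℝ) / 100 < ‖σ‖ → evansOdd hL K h ℓ f θ σ ≠ 0)
    {v : Wcodd L} (hv0 : v ≠ 0) (hv : IsWeakEigen hL K d V ℓ f θ 1 v)
    {σ : ℂ} (hσ : ra < σ.re) :
    (∃ u : Wcodd L, u ≠ 0 ∧ IsWeakEigen hL K d V ℓ f θ σ u) ↔ σ = 1 := by
  have hσm : -m < σ.re := lt_trans hm hσ
  have hra1 : ra < 1 := by norm_num [ra]
  have h1m : -m < (1 : ℂ).re := by rw [Complex.one_re]; linarith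
  have hE1 : evansOdd hL K h ℓ f θ 1 = 0 := (exists_weakEigen_iff_evansOdd_eq_zero hL K h ℓ f θ h1m).1 ⟨v, hv0, hv⟩
  obtain ⟨honly, -⟩ := eq_one_of_zero_and_order_one (analyticOnNhd_evansOdd_rect hL K h hm ℓ f θ) hcert hE1
  constructor
  · intro hex
    have hE : evansOdd hL K h ℓ f θ σ = 0 := (exists_weakEigen_iff_evansOdd_eq_zero hL K h ℓ f θ hσm).1 hex
    by_cases hn : ‖σ‖ ≤ (1141 : ℝ) / 100
    · exact honly σ (halfDisc_subset_rect hσ hn) hE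
    · exact absurd hE (hfar σ hσ (not_le.1 hn))
  · rintro rfl
    exact ⟨v, hv0, hv⟩

/-- **THE SPECTRAL SENTENCE, simplicity half.**  Under the same hypotheses, the weak eigenvalue `σ = 1` is geometrically and algebraically simple:
`R_K(1)f ≠ 0`, the weak eigenvectors at `1` are exactly its multiples, and no weak generalized eigenvector over a non-zero eigenvector exists. [folklore] -/
theorem weakEigen_one_simple (hL : 0 < L) (K : Esp L hL →L[ℝ] W L) (h : GardingDataKC L hL d V K D₀ D₁ V₀ c m) (hm : -m < ra)
    (ℓ : Wcodd L →L[ℂ] ℂ) (f : Wcodd L) (θ : ℂ)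
    (hcert : RectLabelCertificate (evansOdd hL K h ℓ f θ))
    {v : Wcodd L} (hv0 : v ≠ 0) (hv : IsWeakEigen hL K d V ℓ f θ 1 v) :
    resolventOdd hL K h 1 f ≠ 0 ∧
      (∀ u : Wcodd L, IsWeakEigen hL K d V ℓ f θ 1 u ↔ ∃ t : ℂ, u = t • resolventOdd hL K h 1 f) ∧
      ∀ δ₀ : Wcodd L, δ₀ ≠ 0 → IsWeakEigen hL K d V ℓ f θ 1 δ₀ → ¬ ∃ δ₁ : Wcodd L, IsWeakJordan hL K d V ℓ f θ 1 δ₀ δ₁ := by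
  have hra1 : ra < 1 := by norm_num [ra]
  have h1m : -m < (1 : ℂ).re := by rw [Complex.one_re]; linarith
  have hE1 : evansOdd hL K h ℓ f θ 1 = 0 := (exists_weakEigen_iff_evansOdd_eq_zero hL K h ℓ f θ h1m).1 ⟨v, hv0, hv⟩
  obtain ⟨-, horder⟩ := eq_one_of_zero_and_order_one (analyticOnNhd_evansOdd_rect hL K h hm ℓ f θ) hcert hE1
  exact weakEigen_simple_of_analyticOrderAt_eq_one hL K h ℓ f θ h1m horder

/-- **The PASS word, packaged**: the set of `σ` with `Re σ > −3/100` carrying a non-trivial weak eigenvector is `{1}`. [folklore] -/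
theorem weakEigen_set_eq_singleton (hL : 0 < L) (K : Esp L hL →L[ℝ] W L) (h : GardingDataKC L hL d V K D₀ D₁ V₀ c m) (hm : -m < ra)
    (ℓ : Wcodd L →L[ℂ] ℂ) (f : Wcodd L) (θ : ℂ)
    (hcert : RectLabelCertificate (evansOdd hL K h ℓ f θ))
    (hfar : ∀ σ : ℂ, ra < σ.re → (1141 : ℝ) / 100 < ‖σ‖ → evansOdd hL K h ℓ f θ σ ≠ 0)
    {v : Wcodd L} (hv0 : v ≠ 0) (hv : IsWeakEigen hL K d V ℓ f θ 1 v) :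
    {σ : ℂ | ra < σ.re ∧ ∃ u : Wcodd L, u ≠ 0 ∧ IsWeakEigen hL K d V ℓ f θ σ u} = {1} := by
  ext σ
  simp only [Set.mem_setOf_eq, Set.mem_singleton_iff]
  constructor
  · rintro ⟨hσ, hex⟩
    exact (weakEigen_iff_eq_one hL K h hm ℓ f θ hcert hfar hv0 hv hσ).1 hex
  · rintro rfl
    refine ⟨by norm_num [ra, Complex.one_re], v, hv0, hv⟩

end SheetRSpectrumOddAssembly
end Summit.NavierStokesRegularity.OSWSelfSimilar

end
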